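import Summits.CriticalPhenomena.PercolationContinuityZ3.Theorems.Transplant.SkelPhiRootNumbersY
import HarnessLib

/-!
# N1 (the `{±1}` node), (R) column (NEG-SCOPE B.17, y′-family v3): THE ROOMS OF THE y′-LEG — `Skelφ.legY_rooms`: for the third leg of the vertical-direction chain
# (the y′-run `yRunSched … R′ q_Y N_y` in the frame `runY φ c_Y n_L h_L σ′`, origin `φ c_Y = φ t + y_Y`, vertical sign `σ′`, after the x-run prefix in the frame
# `runX φ c_X n_L h_L σ`, hop side `σ`), the five rooms `rootOblTWAt_of_inputsG5_y` asks, from NUMBERS: the regions' footprints in the root world (the prism box read by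
# `footBox_of_runX_mem_Icc`), the x-CLEARANCE of every y′-region off the pinned seed (read off `RunPrm.InRegion`'s transverse bounds: `rootFrame … w 0 = σσ′·b + σ·y_Y 0`),
# nonempty cores (`exists_mem_graphBall_runY_eq`), the CROSS LINK x-core `N_x + 1` ⊆ y′-core `0` (a pure integer hypothesis in root-frame coordinates), the last core's
# footprint in the target box.  `legY_roomsR`: the same with the regions read ONE BY ONE (hp-8 g33's located over-read of the prism hull of a drifting y′-run).

WHY (located (L-R4), lane INBOX 2026-08-21T19:47Z): the y′-run cannot start next to the seed; it starts at the end of the x-prefix, and its clearance is certified by the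
transverse (x) coordinate of its regions, with hop side `σ := σ′·sgn⁺(v_L)` so that the drift `v_L` moves away from the seed (a numeric fact, hypothesis `hclrY`).

builds on p205010 (kernel theorem, internal audit signed; external expert review pending) — nothing in this file uses p205010; nothing here is a claim about the open node.
Lane `prim-bschramm`, seat `prim-bschramm-p3` (gen 10; design owner + (R) owner); helper file (`--supports stmt-CriticalPhenomena-4575 --as helper`).
[cite: KozmaNitzan2024, §4 p. 28 ((32) at the root), Lemma 11 (pp. 22–23)] [cite: MartineauTassion2017, §4.3 Lemma 4.2]
-/

noncomputable section

open MeasureTheory ProbabilityTheory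
open scoped ENNReal Classical

namespace Summit.CriticalPhenomena.PercolationContinuityZ3.Theorems

namespace Transplant

namespace Skelφ

open Literature.Probability.Percolation Literature.Probability.LatticeModels SimpleGraph GadgetSystem ProbeHistory HSiteScheme Contour KNCells
open Literature.Probability.Percolation.KozmaNitzan.Cells (oth sgOf sgOf_sign stepVec_apply_fst)
open KNCells.KSchA KNLevels ChainPlanar ChainPara
open Literature.Barriers.CriticalPhenomena (graphBall mem_graphBall_self graphBall_mono)
open BoxProdZ2 (ConcRadiiG)
open TwoAxis.Para (modulus)

variable {V : Type} {G : SimpleGraph V} [G.LocallyFinite] {φ : V → Site 2}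

/-- **THE ROOMS OF THE y′-LEG** (see the module docstring): footprints of the regions, x-clearance of every region, nonempty cores, the cross link from the x-prefix's
last core, the last core in the target box — from numbers. [cite: KozmaNitzan2024, §4 p. 28 ((32) at the root), Lemma 11 (pp. 22–23)] -/
theorem legY_rooms (hstep : Steps G φ) {t : V} {σ σ' : ℤ} (hσ : σ = 1 ∨ σ = -1) (hσ' : σ' = 1 ∨ σ' = -1) {Rπ : ℕ} (du : MDir)
    -- the fine map
    {Af vα vβ c0f c1f Df : ℤ} (hAf : 0 ≤ Af) {nL : ℕ} (hnL : 1 ≤ nL) (hL : ℤ) (hmf : 0 ≤ modulus nL hL vα vβ) (hc0 : 0 ≤ c0f) (hc1 : 0 ≤ c1f) (hDf : 0 < Df)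
    {flo fhi fw glo ghi gw : ℤ}
    -- the x-prefix (origin `cX`) and the y′-run (origin `cY`)
    {ℓ' : ℕ} (R's : ℕ) {yX : Site 2} (cX : V) (hcX : φ cX = φ t + yX) (qX Nx : ℕ)
    {vL : ℤ} (hvL : |vL| ≤ nL) (hlay : (nL + hL.natAbs : ℕ) ≤ (nL : ℤ) * ℓ' + 1) (qY Ny : ℕ) {yY : Site 2} (cY : V) (hcY : φ cY = φ t + yY)
    {RcY : ℕ} (hcYπ : cY ∈ graphBall G t RcY) {kb : ℕ}
    -- NUMBERS: the y′-run's prism and last core as boxes of the y′-frame (coordinate 0 = level in `[pbLo, pbHi]`, 1 = transverse in `[paLo, paHi]`), their fine readings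
    {paLo pbLo paHi pbHi laLo lbLo laHi lbHi : ℤ} (hprism : (yRunSched hnL hvL hlay R's qY Ny).prism ⊆ Finset.Icc (pt pbLo paLo) (pt pbHi paHi))
    (hlastc : (yRunSched hnL hvL hlay R's qY Ny).core (Ny + 1) ⊆ Finset.Icc (pt lbLo laLo) (pt lbHi laHi))
    {PLO PHI LLO LHI : Site 2}
    (hP0 : PLO 0 ≤ TwoAxis.Para.coarse c0f (Df / 2) Df (TwoAxis.Para.lam0 Af vα vβ yY) +
      (c0f * (Af * (modulus nL hL vα vβ * (min (σ' * paLo) (σ' * paHi)) -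
        max (vα * ((shearUnit nL hL : ℤ) * (min (σ' * pbLo) (σ' * pbHi) - 1))) (vα * ((shearUnit nL hL : ℤ) * (max (σ' * pbLo) (σ' * pbHi)) + shearUnit nL hL - 1))) / nL)) / Df)
    (hP1 : TwoAxis.Para.coarse c0f (Df / 2) Df (TwoAxis.Para.lam0 Af vα vβ yY) +
      (c0f * (Af * (modulus nL hL vα vβ * (max (σ' * paLo) (σ' * paHi)) -
        min (vα * ((shearUnit nL hL : ℤ) * (min (σ' * pbLo) (σ' * pbHi) - 1))) (vα * ((shearUnit nL hL : ℤ) * (max (σ' * pbLo) (σ' * pbHi)) + shearUnit nL hL - 1))) / nL)) / Df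
        + 1 ≤ PHI 0)
    (hP2 : PLO 1 ≤ TwoAxis.Para.coarse c1f (Df / 2) Df (TwoAxis.Para.lam1 Af nL hL yY) + (c1f * (Af * ((shearUnit nL hL : ℤ) * (min (σ' * pbLo) (σ' * pbHi) - 1)))) / Df)
    (hP3 : TwoAxis.Para.coarse c1f (Df / 2) Df (TwoAxis.Para.lam1 Af nL hL yY) +
      (c1f * (Af * ((shearUnit nL hL : ℤ) * (max (σ' * pbLo) (σ' * pbHi)) + shearUnit nL hL - 1))) / Df + 1 ≤ PHI 1)
    (hPf₁ : sgOf du = 1 → flo ≤ PLO du.1 ∧ PHI du.1 ≤ fhi) (hPf₂ : sgOf du = -1 → flo ≤ -PHI du.1 ∧ -PLO du.1 ≤ fhi)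
    (hPf₃ : -fw ≤ PLO (oth du.1) ∧ PHI (oth du.1) ≤ fw)
    (hL0 : LLO 0 ≤ TwoAxis.Para.coarse c0f (Df / 2) Df (TwoAxis.Para.lam0 Af vα vβ yY) +
      (c0f * (Af * (modulus nL hL vα vβ * (min (σ' * laLo) (σ' * laHi)) -
        max (vα * ((shearUnit nL hL : ℤ) * (min (σ' * lbLo) (σ' * lbHi) - 1))) (vα * ((shearUnit nL hL : ℤ) * (max (σ' * lbLo) (σ' * lbHi)) + shearUnit nL hL - 1))) / nL)) / Df)
    (hL1 : TwoAxis.Para.coarse c0f (Df / 2) Df (TwoAxis.Para.lam0 Af vα vβ yY) +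
      (c0f * (Af * (modulus nL hL vα vβ * (max (σ' * laLo) (σ' * laHi)) -
        min (vα * ((shearUnit nL hL : ℤ) * (min (σ' * lbLo) (σ' * lbHi) - 1))) (vα * ((shearUnit nL hL : ℤ) * (max (σ' * lbLo) (σ' * lbHi)) + shearUnit nL hL - 1))) / nL)) / Df
        + 1 ≤ LHI 0)
    (hL2 : LLO 1 ≤ TwoAxis.Para.coarse c1f (Df / 2) Df (TwoAxis.Para.lam1 Af nL hL yY) + (c1f * (Af * ((shearUnit nL hL : ℤ) * (min (σ' * lbLo) (σ' * lbHi) - 1)))) / Df)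
    (hL3 : TwoAxis.Para.coarse c1f (Df / 2) Df (TwoAxis.Para.lam1 Af nL hL yY) +
      (c1f * (Af * ((shearUnit nL hL : ℤ) * (max (σ' * lbLo) (σ' * lbHi)) + shearUnit nL hL - 1))) / Df + 1 ≤ LHI 1)
    (hLg₁ : sgOf du = 1 → glo ≤ LLO du.1 ∧ LHI du.1 ≤ ghi) (hLg₂ : sgOf du = -1 → glo ≤ -LHI du.1 ∧ -LLO du.1 ≤ ghi)
    (hLg₃ : -gw ≤ LLO (oth du.1) ∧ LHI (oth du.1) ≤ gw)
    -- NUMBERS: x-clearance of every region (transverse coordinate), the cross link in root-frame coordinates, the reach inside the window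
    (hclrY : ∀ k ≤ Ny, ∀ b : ℤ, (yPrmW nL ℓ' hL vL R's qY Ny).bLo k - R's - nL ≤ b → b ≤ (yPrmW nL ℓ' hL vL R's qY Ny).bHi k + R's + nL →
      (kb : ℤ) < σ * σ' * b + σ * yY 0)
    (hx₂₃ : ∀ r : Site 2, pt (r 0 - σ * yX 0) ((σ * ((nL : ℤ) * (r 1 - yX 1) - hL * (σ * r 0 - yX 0))) / (shearUnit nL hL : ℤ)) ∈
        (xRunSched nL ℓ' hL R's qX Nx).core (Nx + 1) →
      pt ((σ' * ((nL : ℤ) * (r 1 - yY 1) - hL * (σ * r 0 - yY 0))) / (shearUnit nL hL : ℤ)) (σ' * (σ * r 0 - yY 0)) ∈ (yRunSched hnL hvL hlay R's qY Ny).core 0)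
    (hπ3 : ∀ k ≤ Ny, RcY + (((((k + 1 : ℕ) : ℤ) * vL).natAbs +
      (((shearUnit nL hL : ℤ) * |((k + 1 : ℕ) : ℤ) * (yPrmW nL ℓ' hL vL R's qY Ny).sLo| + |hL| * |((k + 1 : ℕ) : ℤ) * vL| + shearUnit nL hL) / nL).natAbs + 1)) ≤ Rπ) :
    (∀ k ≤ Ny, ∀ w ∈ graphBall G t Rπ, runY φ cY nL hL σ' w ∈ (yRunSched hnL hvL hlay R's qY Ny).region k →
      FootBox flo fhi fw du (fineSkel φ t Af nL hL vα vβ c0f c1f (Df / 2) (Df / 2) Df w)) ∧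
    (∀ k ≤ Ny, ∀ w ∈ graphBall G t Rπ, runY φ cY nL hL σ' w ∈ (yRunSched hnL hvL hlay R's qY Ny).region k → (kb : ℤ) < rootFrame φ t σ w 0) ∧
    (∀ k ≤ Ny, (Win G (runY φ cY nL hL σ') t ((yRunSched hnL hvL hlay R's qY Ny).core (k + 1)) Rπ).Nonempty) ∧
    (∀ w ∈ graphBall G t Rπ, runX φ cX nL hL σ w ∈ (xRunSched nL ℓ' hL R's qX Nx).core (Nx + 1) →
      runY φ cY nL hL σ' w ∈ (yRunSched hnL hvL hlay R's qY Ny).core 0) ∧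
    (∀ w ∈ graphBall G t Rπ, runY φ cY nL hL σ' w ∈ (yRunSched hnL hvL hlay R's qY Ny).core (Ny + 1) →
      FootBox glo ghi gw du (fineSkel φ t Af nL hL vα vβ c0f c1f (Df / 2) (Df / 2) Df w)) := by
  set FS := fineSkel φ t Af nL hL vα vβ c0f c1f (Df / 2) (Df / 2) Df with hFS
  set SY := yRunSched hnL hvL hlay R's qY Ny with hSY
  set SX := xRunSched nL ℓ' hL R's qX Nx with hSX
  have hU0 : 0 < (shearUnit nL hL : ℤ) := shearUnit_pos hnL hL
  have hσsq : σ * σ = 1 := by rcases hσ with rfl | rfl <;> simp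
  have hσsq' : σ' * σ' = 1 := by rcases hσ' with rfl | rfl <;> simp
  obtain ⟨hey0, hey1⟩ := fineSkel_of_φ_eq (φ := φ) t (Af := Af) (nL := nL) (hL := hL) (vα := vα) (vβ := vβ) (c0f := c0f) (c1f := c1f) (Df := Df) hcY
  -- run coordinates versus root-frame coordinates
  have hX0 : ∀ w, runX φ cX nL hL σ w 0 = rootFrame φ t σ w 0 - σ * yX 0 := fun w => by
    rw [runX_zero, relCoord_apply, rootFrame_apply_zero, hcX, Pi.add_apply]; ring
  have hX1 : ∀ w, runX φ cX nL hL σ w 1 = (σ * ((nL : ℤ) * (rootFrame φ t σ w 1 - yX 1) - hL * (σ * rootFrame φ t σ w 0 - yX 0))) / (shearUnit nL hL : ℤ) :=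
    fun w => by
    rw [runX_one, shearCoord_apply, rootFrame_apply_zero, rootFrame_apply_one, hcX, Pi.add_apply, Pi.add_apply]
    congr 1
    have : σ * (σ * (φ w 0 - φ t 0)) = φ w 0 - φ t 0 := by rw [← mul_assoc, hσsq, one_mul]
    rw [this]; ring
  have hY1 : ∀ w, runY φ cY nL hL σ' w 1 = σ' * (σ * rootFrame φ t σ w 0 - yY 0) := fun w => by
    rw [runY_one, relCoord_apply, rootFrame_apply_zero, hcY, Pi.add_apply]
    have : σ * (σ * (φ w 0 - φ t 0)) = φ w 0 - φ t 0 := by rw [← mul_assoc, hσsq, one_mul]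
    rw [this]; ring
  have hY0 : ∀ w, runY φ cY nL hL σ' w 0 = (σ' * ((nL : ℤ) * (rootFrame φ t σ w 1 - yY 1) - hL * (σ * rootFrame φ t σ w 0 - yY 0))) / (shearUnit nL hL : ℤ) :=
    fun w => by
    rw [runY_zero, shearCoord_apply, rootFrame_apply_zero, rootFrame_apply_one, hcY, Pi.add_apply, Pi.add_apply]
    congr 1
    have : σ * (σ * (φ w 0 - φ t 0)) = φ w 0 - φ t 0 := by rw [← mul_assoc, hσsq, one_mul]
    rw [this]; ring
  refine ⟨?_, ?_, ?_, ?_, ?_⟩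
  · -- (1) footprints of the regions (inside the prism)
    intro k hk w _ hw
    have hw' := runY_sign_mem_Icc cY hnL hL hσ' (hprism (SY.sub_prism k hk hw))
    refine footBox_of_runX_mem_Icc t hAf hnL hmf hc0 hc1 hDf cY (LO := PLO) (HI := PHI) ?_ ?_ ?_ ?_ hPf₁ hPf₂ hPf₃ hw'
    · rw [hey0]; simpa only [pt_zero, pt_one] using hP0
    · rw [hey0]; simpa only [pt_zero, pt_one] using hP1
    · rw [hey1]; simpa only [pt_zero, pt_one] using hP2
    · rw [hey1]; simpa only [pt_zero, pt_one] using hP3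
  · -- (2) x-clearance of every region, from its transverse bounds
    intro k hk w _ hw
    rw [hSY, yRunSched, mem_scheduleN_region_iff (yPrmW_ok hnL hvL hlay R's qY Ny) (yPrmW_eb nL ℓ' hL vL R's qY Ny)] at hw
    obtain ⟨-, -, h3, h4⟩ := hw
    have heb : ((yPrmW nL ℓ' hL vL R's qY Ny).eb : ℤ) = R's := rfl
    have hLb : ((yPrmW nL ℓ' hL vL R's qY Ny).Lb : ℤ) = nL := rfl
    rw [heb, hLb, hY1] at h3 h4
    have hr : rootFrame φ t σ w 0 = σ * σ' * (σ' * (σ * rootFrame φ t σ w 0 - yY 0)) + σ * yY 0 := by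
      have e : σ * σ' * (σ' * (σ * rootFrame φ t σ w 0 - yY 0)) = σ * (σ' * σ') * (σ * rootFrame φ t σ w 0) - σ * (σ' * σ') * yY 0 := by ring
      rw [e, hσsq', mul_one, ← mul_assoc, hσsq, one_mul]; ring
    rw [hr]
    exact hclrY k hk _ h3 h4
  · -- (3) nonempty cores: the nominal point after `k+1` strides is a vertex of the ball
    intro k hk
    obtain ⟨g, hg, hφg⟩ := exists_mem_graphBall_runY_eq hstep hnL cY hL hσ'
      (pt (((k + 1 : ℕ) : ℤ) * (yPrmW nL ℓ' hL vL R's qY Ny).sLo) (((k + 1 : ℕ) : ℤ) * vL))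
    refine ⟨g, (mem_Win G _).2 ⟨?_, ?_⟩⟩
    · have h := BoxProdZ2.mem_graphBall_add G hcYπ hg
      refine graphBall_mono G t ?_ h
      have := hπ3 k hk
      simpa only [pt_zero, pt_one] using this
    · rw [hSY, yRunSched, mem_scheduleN_core_iff (yPrmW_ok hnL hvL hlay R's qY Ny) (yPrmW_eb nL ℓ' hL vL R's qY Ny), hφg, pt_zero, pt_one]
      have hnom := RunPrm.inCore_nominal (yPrmW_ok hnL hvL hlay R's qY Ny) (k + 1)
      have hd : ((yPrmW nL ℓ' hL vL R's qY Ny).d : ℤ) = vL := rfl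
      rw [hd] at hnom
      simpa only [Nat.cast_add, Nat.cast_one] using hnom
  · -- (4) the cross link: x-core `Nx + 1` into y′-core `0`, in root-frame coordinates
    intro w _ hw
    have eX : runX φ cX nL hL σ w = pt (rootFrame φ t σ w 0 - σ * yX 0)
        ((σ * ((nL : ℤ) * (rootFrame φ t σ w 1 - yX 1) - hL * (σ * rootFrame φ t σ w 0 - yX 0))) / (shearUnit nL hL : ℤ)) := by
      funext i; fin_cases i
      · exact hX0 w
      · exact hX1 w
    have eY : runY φ cY nL hL σ' w = pt ((σ' * ((nL : ℤ) * (rootFrame φ t σ w 1 - yY 1) - hL * (σ * rootFrame φ t σ w 0 - yY 0))) / (shearUnit nL hL : ℤ))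
        (σ' * (σ * rootFrame φ t σ w 0 - yY 0)) := by
      funext i; fin_cases i
      · exact hY0 w
      · exact hY1 w
    rw [eY]
    exact hx₂₃ (rootFrame φ t σ w) (eX ▸ hw)
  · -- (5) the last core in the target box
    intro w _ hw
    have hw' := runY_sign_mem_Icc cY hnL hL hσ' (hlastc hw)
    refine footBox_of_runX_mem_Icc t hAf hnL hmf hc0 hc1 hDf cY (LO := LLO) (HI := LHI) ?_ ?_ ?_ ?_ hLg₁ hLg₂ hLg₃ hw'
    · rw [hey0]; simpa only [pt_zero, pt_one] using hL0
    · rw [hey0]; simpa only [pt_zero, pt_one] using hL1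
    · rw [hey1]; simpa only [pt_zero, pt_one] using hL2
    · rw [hey1]; simpa only [pt_zero, pt_one] using hL3

/-- **THE ROOMS OF THE y′-LEG, REGIONS READ ONE BY ONE** (hp-8 g33's located item, lane INBOX 2026-08-21T20:4xZ: for a DRIFTING y′-run (`d = v_L ≠ 0`) the fine reading
of the prism HULL over-reads by `≈ 2N·|v_L|/n_L` strides, so the regions' footprints are read per step `k` from boxes `[qbLo k, qbHi k] × [qaLo k, qaHi k]` ⊇ region `k`);
otherwise as `legY_rooms`. [cite: KozmaNitzan2024, §4 p. 28 ((32) at the root), Lemma 11 (pp. 22–23)] -/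
theorem legY_roomsR (hstep : Steps G φ) {t : V} {σ σ' : ℤ} (hσ : σ = 1 ∨ σ = -1) (hσ' : σ' = 1 ∨ σ' = -1) {Rπ : ℕ} (du : MDir)
    -- the fine map
    {Af vα vβ c0f c1f Df : ℤ} (hAf : 0 ≤ Af) {nL : ℕ} (hnL : 1 ≤ nL) (hL : ℤ) (hmf : 0 ≤ modulus nL hL vα vβ) (hc0 : 0 ≤ c0f) (hc1 : 0 ≤ c1f) (hDf : 0 < Df)
    {flo fhi fw glo ghi gw : ℤ}
    -- the x-prefix (origin `cX`) and the y′-run (origin `cY`)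
    {ℓ' : ℕ} (R's : ℕ) {yX : Site 2} (cX : V) (hcX : φ cX = φ t + yX) (qX Nx : ℕ)
    {vL : ℤ} (hvL : |vL| ≤ nL) (hlay : (nL + hL.natAbs : ℕ) ≤ (nL : ℤ) * ℓ' + 1) (qY Ny : ℕ) {yY : Site 2} (cY : V) (hcY : φ cY = φ t + yY)
    {RcY : ℕ} (hcYπ : cY ∈ graphBall G t RcY) {kb : ℕ}
    -- NUMBERS: the y′-run's REGIONS ONE BY ONE and its last core as boxes of the y′-frame (coordinate 0 = level in `[qbLo k, qbHi k]`, 1 = transverse in `[qaLo k, qaHi k]`), readings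
    {qaLo qbLo qaHi qbHi : ℕ → ℤ} (hregion : ∀ k ≤ Ny, (yRunSched hnL hvL hlay R's qY Ny).region k ⊆ Finset.Icc (pt (qbLo k) (qaLo k)) (pt (qbHi k) (qaHi k)))
    {laLo lbLo laHi lbHi : ℤ} (hlastc : (yRunSched hnL hvL hlay R's qY Ny).core (Ny + 1) ⊆ Finset.Icc (pt lbLo laLo) (pt lbHi laHi))
    {PLO PHI : ℕ → Site 2} {LLO LHI : Site 2}
    (hP0 : ∀ k ≤ Ny, PLO k 0 ≤ TwoAxis.Para.coarse c0f (Df / 2) Df (TwoAxis.Para.lam0 Af vα vβ yY) +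
      (c0f * (Af * (modulus nL hL vα vβ * (min (σ' * qaLo k) (σ' * qaHi k)) -
        max (vα * ((shearUnit nL hL : ℤ) * (min (σ' * qbLo k) (σ' * qbHi k) - 1))) (vα * ((shearUnit nL hL : ℤ) * (max (σ' * qbLo k) (σ' * qbHi k)) + shearUnit nL hL - 1))) / nL)) / Df)
    (hP1 : ∀ k ≤ Ny, TwoAxis.Para.coarse c0f (Df / 2) Df (TwoAxis.Para.lam0 Af vα vβ yY) +
      (c0f * (Af * (modulus nL hL vα vβ * (max (σ' * qaLo k) (σ' * qaHi k)) -
        min (vα * ((shearUnit nL hL : ℤ) * (min (σ' * qbLo k) (σ' * qbHi k) - 1))) (vα * ((shearUnit nL hL : ℤ) * (max (σ' * qbLo k) (σ' * qbHi k)) + shearUnit nL hL - 1))) / nL)) / Df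
        + 1 ≤ PHI k 0)
    (hP2 : ∀ k ≤ Ny, PLO k 1 ≤ TwoAxis.Para.coarse c1f (Df / 2) Df (TwoAxis.Para.lam1 Af nL hL yY) + (c1f * (Af * ((shearUnit nL hL : ℤ) * (min (σ' * qbLo k) (σ' * qbHi k) - 1)))) / Df)
    (hP3 : ∀ k ≤ Ny, TwoAxis.Para.coarse c1f (Df / 2) Df (TwoAxis.Para.lam1 Af nL hL yY) +
      (c1f * (Af * ((shearUnit nL hL : ℤ) * (max (σ' * qbLo k) (σ' * qbHi k)) + shearUnit nL hL - 1))) / Df + 1 ≤ PHI k 1)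
    (hPf₁ : ∀ k ≤ Ny, sgOf du = 1 → flo ≤ PLO k du.1 ∧ PHI k du.1 ≤ fhi) (hPf₂ : ∀ k ≤ Ny, sgOf du = -1 → flo ≤ -PHI k du.1 ∧ -PLO k du.1 ≤ fhi)
    (hPf₃ : ∀ k ≤ Ny, -fw ≤ PLO k (oth du.1) ∧ PHI k (oth du.1) ≤ fw)
    (hL0 : LLO 0 ≤ TwoAxis.Para.coarse c0f (Df / 2) Df (TwoAxis.Para.lam0 Af vα vβ yY) +
      (c0f * (Af * (modulus nL hL vα vβ * (min (σ' * laLo) (σ' * laHi)) -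
        max (vα * ((shearUnit nL hL : ℤ) * (min (σ' * lbLo) (σ' * lbHi) - 1))) (vα * ((shearUnit nL hL : ℤ) * (max (σ' * lbLo) (σ' * lbHi)) + shearUnit nL hL - 1))) / nL)) / Df)
    (hL1 : TwoAxis.Para.coarse c0f (Df / 2) Df (TwoAxis.Para.lam0 Af vα vβ yY) +
      (c0f * (Af * (modulus nL hL vα vβ * (max (σ' * laLo) (σ' * laHi)) -
        min (vα * ((shearUnit nL hL : ℤ) * (min (σ' * lbLo) (σ' * lbHi) - 1))) (vα * ((shearUnit nL hL : ℤ) * (max (σ' * lbLo) (σ' * lbHi)) + shearUnit nL hL - 1))) / nL)) / Df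
        + 1 ≤ LHI 0)
    (hL2 : LLO 1 ≤ TwoAxis.Para.coarse c1f (Df / 2) Df (TwoAxis.Para.lam1 Af nL hL yY) + (c1f * (Af * ((shearUnit nL hL : ℤ) * (min (σ' * lbLo) (σ' * lbHi) - 1)))) / Df)
    (hL3 : TwoAxis.Para.coarse c1f (Df / 2) Df (TwoAxis.Para.lam1 Af nL hL yY) +
      (c1f * (Af * ((shearUnit nL hL : ℤ) * (max (σ' * lbLo) (σ' * lbHi)) + shearUnit nL hL - 1))) / Df + 1 ≤ LHI 1)
    (hLg₁ : sgOf du = 1 → glo ≤ LLO du.1 ∧ LHI du.1 ≤ ghi) (hLg₂ : sgOf du = -1 → glo ≤ -LHI du.1 ∧ -LLO du.1 ≤ ghi)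
    (hLg₃ : -gw ≤ LLO (oth du.1) ∧ LHI (oth du.1) ≤ gw)
    -- NUMBERS: x-clearance of every region (transverse coordinate), the cross link in root-frame coordinates, the reach inside the window
    (hclrY : ∀ k ≤ Ny, ∀ b : ℤ, (yPrmW nL ℓ' hL vL R's qY Ny).bLo k - R's - nL ≤ b → b ≤ (yPrmW nL ℓ' hL vL R's qY Ny).bHi k + R's + nL →
      (kb : ℤ) < σ * σ' * b + σ * yY 0)
    (hx₂₃ : ∀ r : Site 2, pt (r 0 - σ * yX 0) ((σ * ((nL : ℤ) * (r 1 - yX 1) - hL * (σ * r 0 - yX 0))) / (shearUnit nL hL : ℤ)) ∈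
        (xRunSched nL ℓ' hL R's qX Nx).core (Nx + 1) →
      pt ((σ' * ((nL : ℤ) * (r 1 - yY 1) - hL * (σ * r 0 - yY 0))) / (shearUnit nL hL : ℤ)) (σ' * (σ * r 0 - yY 0)) ∈ (yRunSched hnL hvL hlay R's qY Ny).core 0)
    (hπ3 : ∀ k ≤ Ny, RcY + (((((k + 1 : ℕ) : ℤ) * vL).natAbs +
      (((shearUnit nL hL : ℤ) * |((k + 1 : ℕ) : ℤ) * (yPrmW nL ℓ' hL vL R's qY Ny).sLo| + |hL| * |((k + 1 : ℕ) : ℤ) * vL| + shearUnit nL hL) / nL).natAbs + 1)) ≤ Rπ) :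
    (∀ k ≤ Ny, ∀ w ∈ graphBall G t Rπ, runY φ cY nL hL σ' w ∈ (yRunSched hnL hvL hlay R's qY Ny).region k →
      FootBox flo fhi fw du (fineSkel φ t Af nL hL vα vβ c0f c1f (Df / 2) (Df / 2) Df w)) ∧
    (∀ k ≤ Ny, ∀ w ∈ graphBall G t Rπ, runY φ cY nL hL σ' w ∈ (yRunSched hnL hvL hlay R's qY Ny).region k → (kb : ℤ) < rootFrame φ t σ w 0) ∧
    (∀ k ≤ Ny, (Win G (runY φ cY nL hL σ') t ((yRunSched hnL hvL hlay R's qY Ny).core (k + 1)) Rπ).Nonempty) ∧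
    (∀ w ∈ graphBall G t Rπ, runX φ cX nL hL σ w ∈ (xRunSched nL ℓ' hL R's qX Nx).core (Nx + 1) →
      runY φ cY nL hL σ' w ∈ (yRunSched hnL hvL hlay R's qY Ny).core 0) ∧
    (∀ w ∈ graphBall G t Rπ, runY φ cY nL hL σ' w ∈ (yRunSched hnL hvL hlay R's qY Ny).core (Ny + 1) →
      FootBox glo ghi gw du (fineSkel φ t Af nL hL vα vβ c0f c1f (Df / 2) (Df / 2) Df w)) := by
  set FS := fineSkel φ t Af nL hL vα vβ c0f c1f (Df / 2) (Df / 2) Df with hFS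
  set SY := yRunSched hnL hvL hlay R's qY Ny with hSY
  set SX := xRunSched nL ℓ' hL R's qX Nx with hSX
  have hU0 : 0 < (shearUnit nL hL : ℤ) := shearUnit_pos hnL hL
  have hσsq : σ * σ = 1 := by rcases hσ with rfl | rfl <;> simp
  have hσsq' : σ' * σ' = 1 := by rcases hσ' with rfl | rfl <;> simp
  obtain ⟨hey0, hey1⟩ := fineSkel_of_φ_eq (φ := φ) t (Af := Af) (nL := nL) (hL := hL) (vα := vα) (vβ := vβ) (c0f := c0f) (c1f := c1f) (Df := Df) hcY
  -- run coordinates versus root-frame coordinates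
  have hX0 : ∀ w, runX φ cX nL hL σ w 0 = rootFrame φ t σ w 0 - σ * yX 0 := fun w => by
    rw [runX_zero, relCoord_apply, rootFrame_apply_zero, hcX, Pi.add_apply]; ring
  have hX1 : ∀ w, runX φ cX nL hL σ w 1 = (σ * ((nL : ℤ) * (rootFrame φ t σ w 1 - yX 1) - hL * (σ * rootFrame φ t σ w 0 - yX 0))) / (shearUnit nL hL : ℤ) :=
    fun w => by
    rw [runX_one, shearCoord_apply, rootFrame_apply_zero, rootFrame_apply_one, hcX, Pi.add_apply, Pi.add_apply]
    congr 1
    have : σ * (σ * (φ w 0 - φ t 0)) = φ w 0 - φ t 0 := by rw [← mul_assoc, hσsq, one_mul]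
    rw [this]; ring
  have hY1 : ∀ w, runY φ cY nL hL σ' w 1 = σ' * (σ * rootFrame φ t σ w 0 - yY 0) := fun w => by
    rw [runY_one, relCoord_apply, rootFrame_apply_zero, hcY, Pi.add_apply]
    have : σ * (σ * (φ w 0 - φ t 0)) = φ w 0 - φ t 0 := by rw [← mul_assoc, hσsq, one_mul]
    rw [this]; ring
  have hY0 : ∀ w, runY φ cY nL hL σ' w 0 = (σ' * ((nL : ℤ) * (rootFrame φ t σ w 1 - yY 1) - hL * (σ * rootFrame φ t σ w 0 - yY 0))) / (shearUnit nL hL : ℤ) :=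
    fun w => by
    rw [runY_zero, shearCoord_apply, rootFrame_apply_zero, rootFrame_apply_one, hcY, Pi.add_apply, Pi.add_apply]
    congr 1
    have : σ * (σ * (φ w 0 - φ t 0)) = φ w 0 - φ t 0 := by rw [← mul_assoc, hσsq, one_mul]
    rw [this]; ring
  refine ⟨?_, ?_, ?_, ?_, ?_⟩
  · -- (1) footprints of the regions, region by region
    intro k hk w _ hw
    have hw' := runY_sign_mem_Icc cY hnL hL hσ' (hregion k hk hw)
    refine footBox_of_runX_mem_Icc t hAf hnL hmf hc0 hc1 hDf cY (LO := PLO k) (HI := PHI k) ?_ ?_ ?_ ?_ (hPf₁ k hk) (hPf₂ k hk) (hPf₃ k hk) hw'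
    · rw [hey0]; simpa only [pt_zero, pt_one] using hP0 k hk
    · rw [hey0]; simpa only [pt_zero, pt_one] using hP1 k hk
    · rw [hey1]; simpa only [pt_zero, pt_one] using hP2 k hk
    · rw [hey1]; simpa only [pt_zero, pt_one] using hP3 k hk
  · -- (2) x-clearance of every region, from its transverse bounds
    intro k hk w _ hw
    rw [hSY, yRunSched, mem_scheduleN_region_iff (yPrmW_ok hnL hvL hlay R's qY Ny) (yPrmW_eb nL ℓ' hL vL R's qY Ny)] at hw
    obtain ⟨-, -, h3, h4⟩ := hw
    have heb : ((yPrmW nL ℓ' hL vL R's qY Ny).eb : ℤ) = R's := rfl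
    have hLb : ((yPrmW nL ℓ' hL vL R's qY Ny).Lb : ℤ) = nL := rfl
    rw [heb, hLb, hY1] at h3 h4
    have hr : rootFrame φ t σ w 0 = σ * σ' * (σ' * (σ * rootFrame φ t σ w 0 - yY 0)) + σ * yY 0 := by
      have e : σ * σ' * (σ' * (σ * rootFrame φ t σ w 0 - yY 0)) = σ * (σ' * σ') * (σ * rootFrame φ t σ w 0) - σ * (σ' * σ') * yY 0 := by ring
      rw [e, hσsq', mul_one, ← mul_assoc, hσsq, one_mul]; ring
    rw [hr]
    exact hclrY k hk _ h3 h4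
  · -- (3) nonempty cores: the nominal point after `k+1` strides is a vertex of the ball
    intro k hk
    obtain ⟨g, hg, hφg⟩ := exists_mem_graphBall_runY_eq hstep hnL cY hL hσ'
      (pt (((k + 1 : ℕ) : ℤ) * (yPrmW nL ℓ' hL vL R's qY Ny).sLo) (((k + 1 : ℕ) : ℤ) * vL))
    refine ⟨g, (mem_Win G _).2 ⟨?_, ?_⟩⟩
    · have h := BoxProdZ2.mem_graphBall_add G hcYπ hg
      refine graphBall_mono G t ?_ h
      have := hπ3 k hk
      simpa only [pt_zero, pt_one] using this
    · rw [hSY, yRunSched, mem_scheduleN_core_iff (yPrmW_ok hnL hvL hlay R's qY Ny) (yPrmW_eb nL ℓ' hL vL R's qY Ny), hφg, pt_zero, pt_one]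
      have hnom := RunPrm.inCore_nominal (yPrmW_ok hnL hvL hlay R's qY Ny) (k + 1)
      have hd : ((yPrmW nL ℓ' hL vL R's qY Ny).d : ℤ) = vL := rfl
      rw [hd] at hnom
      simpa only [Nat.cast_add, Nat.cast_one] using hnom
  · -- (4) the cross link: x-core `Nx + 1` into y′-core `0`, in root-frame coordinates
    intro w _ hw
    have eX : runX φ cX nL hL σ w = pt (rootFrame φ t σ w 0 - σ * yX 0)
        ((σ * ((nL : ℤ) * (rootFrame φ t σ w 1 - yX 1) - hL * (σ * rootFrame φ t σ w 0 - yX 0))) / (shearUnit nL hL : ℤ)) := by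
      funext i; fin_cases i
      · exact hX0 w
      · exact hX1 w
    have eY : runY φ cY nL hL σ' w = pt ((σ' * ((nL : ℤ) * (rootFrame φ t σ w 1 - yY 1) - hL * (σ * rootFrame φ t σ w 0 - yY 0))) / (shearUnit nL hL : ℤ))
        (σ' * (σ * rootFrame φ t σ w 0 - yY 0)) := by
      funext i; fin_cases i
      · exact hY0 w
      · exact hY1 w
    rw [eY]
    exact hx₂₃ (rootFrame φ t σ w) (eX ▸ hw)
  · -- (5) the last core in the target box
    intro w _ hw
    have hw' := runY_sign_mem_Icc cY hnL hL hσ' (hlastc hw)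
    refine footBox_of_runX_mem_Icc t hAf hnL hmf hc0 hc1 hDf cY (LO := LLO) (HI := LHI) ?_ ?_ ?_ ?_ hLg₁ hLg₂ hLg₃ hw'
    · rw [hey0]; simpa only [pt_zero, pt_one] using hL0
    · rw [hey0]; simpa only [pt_zero, pt_one] using hL1
    · rw [hey1]; simpa only [pt_zero, pt_one] using hL2
    · rw [hey1]; simpa only [pt_zero, pt_one] using hL3

end Skelφ

end Transplant

end Summit.CriticalPhenomena.PercolationContinuityZ3.Theorems

end
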